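import Summits.BirchSwinnertonDyer.BirchSwinnertonDyer.Theorems.GenusKolyvaginAtTwoKolyvaginExactAtTwoTranspositionPrimes
import Literature.NumberTheory.EllipticCurves.SelmerGaloisActionPlaces
import Literature.NumberTheory.EllipticCurves.CasselsTateSelmerKolyvaginValue

/-!
# Route `GenusKolyvaginAtTwo`, crux #3 `KolyvaginExactAtTwo` (stmt-BirchSwinnertonDyer-22137):
# the TRANSPORT leaf (TR₂) discharged — `σ_*` carries `ker (H¹(K,E[n]) → H¹(K_v,E[n]))` onto the
# kernel at `σ v` — and (F4′) / Prop. 2.3 at `2` with one hypothesis fewer (helper, PROVED;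
# seat `bsd-line-gk2-p2`, gen 4)

The kernel skeleton `GenusExact.conjAct_eq_self_of_admissible` (file `…TranspositionPrimes`, §6)
asked, at each admissible place `v`, for the transport «`x ∈ T_v → τ x ∈ T_v`» of the local kernel
`T_v = (W⁄K).torsionLocalKer K_v n` under complex conjugation. This is folklore and is PROVED here
from the tree: `σ_*` intertwines the localisation maps (`conjActPlace_localization`,
`SelmerGaloisActionPlaces`) and membership in `T_v` is vanishing of the localisation
(`mem_torsionLocalKer_iff_res_eq_zero`, `CasselsTateSelmerKolyvaginValue`). Consequences: the
leaf list of memo ANALYSIS-22137 v5.3 §8 / `LeavesAtTwo.lean` (evidence #17) loses TR₂; the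
concrete (F4′) and the assembled Prop. 2.3 at `2` are restated with «`c • v = v`» (the admissible
prime is inert) in place of the transport clause. Helper for the crux item (`--supports`); BSD is not
proved by any of this.
-/

set_option linter.dupNamespace false

noncomputable section

open scoped Classical

namespace Summit.BirchSwinnertonDyer.BirchSwinnertonDyer.Theorems.GenusExact

open Literature.NumberTheory.EllipticCurves Literature.NumberTheory.GaloisRepresentations
  WeierstrassCurve IsDedekindDomain NumberField

variable {K : Type} [Field K] [NumberField K] (W : WeierstrassCurve ℚ) [W.IsElliptic]

/-- **Transport of the local kernel (TR₂).** For `σ ∈ Aut(K/ℚ)` with `σ • v = w` and `k ≥ 1`: if a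
class `x ∈ H¹(K, E[k])` dies in `H¹(K_v, E[k])` then `σ_* x` dies in `H¹(K_w, E[k])` — because
`loc_w (σ_* x) = σ_* (loc_v x)` (Cassels–Fröhlich VII §1.1; tree `conjActPlace_localization`).
[cite: CasselsFrohlichANT1967, Ch. VII §1.1] -/
theorem conjAct_mem_torsionLocalKer (σ : K ≃ₐ[ℚ] K) {k : ℕ} (hk : k ≠ 0)
    {v w : HeightOneSpectrum (𝓞 K)} (h : σ • v = w)
    {x : galH1Torsion (W.baseChange K) (k : ℤ)}
    (hx : x ∈ (W.baseChange K).torsionLocalKer (v.adicCompletion K) (k : ℤ)) :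
    conjAct W σ (k : ℤ) x ∈ (W.baseChange K).torsionLocalKer (w.adicCompletion K) (k : ℤ) := by
  haveI : (W.baseChange K).IsElliptic := inferInstanceAs (W.map (algebraMap ℚ K)).IsElliptic
  haveI : CharZero (v.adicCompletion K) :=
    charZero_of_injective_algebraMap (algebraMap K _).injective
  haveI : CharZero (w.adicCompletion K) :=
    charZero_of_injective_algebraMap (algebraMap K _).injective
  rw [mem_torsionLocalKer_iff_res_eq_zero (W.baseChange K) (v.adicCompletion K) hk] at hx
  rw [mem_torsionLocalKer_iff_res_eq_zero (W.baseChange K) (w.adicCompletion K) hk]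
  have hloc := conjActPlace_localization W σ (k : ℤ) h x
  change galoisCohomology.localization ((W.baseChange K).torsionGaloisModule (k : ℤ))
    (Sum.inr w : Place K) 1 (conjAct W σ (k : ℤ) x) = 0
  have hx' : galoisCohomology.localization ((W.baseChange K).torsionGaloisModule (k : ℤ))
      (Sum.inr v : Place K) 1 x = 0 := hx
  rw [← hloc, hx', map_zero]

/-- TR₂ at a `σ`-stable place (`σ • v = v`: an inert prime under complex conjugation): `σ_*`
preserves `T_v`; with `k = 2`. [cite: CasselsFrohlichANT1967, Ch. VII §1.1] -/
theorem conjAct_two_mem_torsionLocalKer_of_smul_eq (σ : K ≃ₐ[ℚ] K) {v : HeightOneSpectrum (𝓞 K)}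
    (h : σ • v = v) :
    ∀ x ∈ (W.baseChange K).torsionLocalKer (v.adicCompletion K) ((2 : ℕ) : ℤ),
      conjAct W σ ((2 : ℕ) : ℤ) x ∈ (W.baseChange K).torsionLocalKer (v.adicCompletion K) ((2 : ℕ) : ℤ) :=
  fun _ hx ↦ conjAct_mem_torsionLocalKer W σ two_ne_zero h hx

variable (K)

/-- **(F4′) on `Sel^(2)(E/K)` with TR₂ discharged**: `Gal(K/ℚ)` acts trivially on the `2`-Selmer
group, granted for every Selmer class `s` with `s + τ s ≠ 0` an admissible INERT place `v`
(`c • v = v`) for the pair `(κ, s + τ s)` — `κ ∉ T_v`, the hyperplane constraint for `s`, and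
`s + τ s ∉ T_v` unless `s + τ s = κ`. [cite: GrossLMS1991, §10] [cite: McCallumLMS1991, Cor. 3.2] -/
theorem conjAct_eq_self_of_admissible_inert (c : K ≃ₐ[ℚ] K)
    {κ : galH1Torsion (W.baseChange K) ((2 : ℕ) : ℤ)}
    (hκ : κ ∈ selmerGroup (W.baseChange K) ((2 : ℕ) : ℤ))
    (hτκ : conjAct W c ((2 : ℕ) : ℤ) κ = κ)
    (hadm : ∀ s ∈ selmerGroup (W.baseChange K) ((2 : ℕ) : ℤ), s + conjAct W c ((2 : ℕ) : ℤ) s ≠ 0 →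
      ∃ v : HeightOneSpectrum (𝓞 K), c • v = v ∧
        κ ∉ (W.baseChange K).torsionLocalKer (v.adicCompletion K) ((2 : ℕ) : ℤ) ∧
        (s ∈ (W.baseChange K).torsionLocalKer (v.adicCompletion K) ((2 : ℕ) : ℤ) ∨
          s - κ ∈ (W.baseChange K).torsionLocalKer (v.adicCompletion K) ((2 : ℕ) : ℤ)) ∧
        (s + conjAct W c ((2 : ℕ) : ℤ) s ∈
            (W.baseChange K).torsionLocalKer (v.adicCompletion K) ((2 : ℕ) : ℤ) →
          s + conjAct W c ((2 : ℕ) : ℤ) s = κ)) :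
    ∀ s ∈ selmerGroup (W.baseChange K) ((2 : ℕ) : ℤ), conjAct W c ((2 : ℕ) : ℤ) s = s := by
  refine conjAct_eq_self_of_admissible W K c hκ hτκ fun s hs hne ↦ ?_
  obtain ⟨v, hcv, h1, h2, h3⟩ := hadm s hs hne
  exact ⟨v, conjAct_two_mem_torsionLocalKer_of_smul_eq W c hcv, h1, h2, h3⟩

/-- **Prop. 2.3 at `p = 2` from the two halves, TR₂ discharged**: admissible inert places for all
Selmer classes (F4′) and the `ℚ`-side input «`τ`-invariant Selmer classes are `0` or `κ`» give
`#Sel^(2)(E/K) = 2`. [cite: GrossLMS1991, §2 Prop. 2.3] -/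
theorem natCard_selmerGroup_two_eq_two_of_admissible_inert (c : K ≃ₐ[ℚ] K)
    {κ : galH1Torsion (W.baseChange K) ((2 : ℕ) : ℤ)}
    (hκ : κ ∈ selmerGroup (W.baseChange K) ((2 : ℕ) : ℤ)) (hκ0 : κ ≠ 0)
    (hτκ : conjAct W c ((2 : ℕ) : ℤ) κ = κ)
    (hadm : ∀ s ∈ selmerGroup (W.baseChange K) ((2 : ℕ) : ℤ), s + conjAct W c ((2 : ℕ) : ℤ) s ≠ 0 →
      ∃ v : HeightOneSpectrum (𝓞 K), c • v = v ∧
        κ ∉ (W.baseChange K).torsionLocalKer (v.adicCompletion K) ((2 : ℕ) : ℤ) ∧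
        (s ∈ (W.baseChange K).torsionLocalKer (v.adicCompletion K) ((2 : ℕ) : ℤ) ∨
          s - κ ∈ (W.baseChange K).torsionLocalKer (v.adicCompletion K) ((2 : ℕ) : ℤ)) ∧
        (s + conjAct W c ((2 : ℕ) : ℤ) s ∈
            (W.baseChange K).torsionLocalKer (v.adicCompletion K) ((2 : ℕ) : ℤ) →
          s + conjAct W c ((2 : ℕ) : ℤ) s = κ))
    (hinv : ∀ s ∈ selmerGroup (W.baseChange K) ((2 : ℕ) : ℤ),
      conjAct W c ((2 : ℕ) : ℤ) s = s → s = 0 ∨ s = κ) :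
    Nat.card (selmerGroup (W.baseChange K) ((2 : ℕ) : ℤ)) = 2 := by
  refine natCard_selmerGroup_two_eq_two_of_admissible W K c hκ hκ0 hτκ (fun s hs hne ↦ ?_) hinv
  obtain ⟨v, hcv, h1, h2, h3⟩ := hadm s hs hne
  exact ⟨v, conjAct_two_mem_torsionLocalKer_of_smul_eq W c hcv, h1, h2, h3⟩

end Summit.BirchSwinnertonDyer.BirchSwinnertonDyer.Theorems.GenusExact

end
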